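import Summits.AtomisticToContinuum.Crystallization.Theorems.PricedLinkCensusStackingHingeShapeModulus
import Summits.AtomisticToContinuum.Crystallization.Theorems.PricedLinkCensusStackingHingeRatioLipschitz
import Summits.AtomisticToContinuum.Crystallization.Theorems.PricedLinkCensusStackingHingeBoxModulusOfShape

/-!
# The box modulus of the relaxed hcp energy (m3′ of line `Sketch`, crux `PricedLinkCensus.StackingHinge`, stmt-AtomisticToContinuum-14993)

`(a, h) ↦ e(hcp a h) = (hcpPeriodicConfiguration ha hh).energyPerParticle lennardJones` has a minimiser `(a₀, h₀)` on the box
`B = {47/50 ≤ a ≤ 1, 39/50·a ≤ h ≤ 17/20·a}` with a QUADRATIC MODULUS `c > 0`: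
`e(hcp a₀ h₀) + c ((a − a₀)² + (h − h₀)²) ≤ e(hcp a h)` on `B`.  This strengthens item 3066 (`HcpEnergyMinOnBox`, existence)
and is verbatim the hypothesis `hMod` of the landed `PricedHcpWindowsIdealPricing.stub_idealPolytypePricing`.

Assembly of three landed stubs, no numerics here: `PricedHcpWindowsShapeModulus.stub_shapeModulus` (quadratic modulus of the
shape function `S₃²/S₆` of the certified hcp lattice sums about its maximiser `c₀ ∈ (0.78, 0.85)`, from the certified Fermat
positivity `EkelandSurgeryParityUniq.shape_fermat_pos`), `PricedHcpWindowsRatioLipschitz.stub_ratioLipschitz` (`S₃/S₆` Lipschitz),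
`PricedHcpWindowsBoxModulus.stub_boxModulusOfShape` (algebra in `(a, c = h/a)`). [folklore]
-/

namespace Summit.AtomisticToContinuum.Crystallization.Theorems.PricedHcpWindowsHcpBoxModulus

/-- **m3′, the box modulus of `e(hcp a h)`** (registered stub `stub_hcpBoxModulus` of crux stmt-AtomisticToContinuum-14993;
the hypothesis `hMod` of `stub_idealPolytypePricing`). [folklore] -/
theorem stub_hcpBoxModulus : ∃ (a₀ h₀ : ℝ) (ha₀ : a₀ ≠ 0) (hh₀ : h₀ ≠ 0) (c : ℝ), 0 < c ∧ (47 / 50 ≤ a₀ ∧ a₀ ≤ 1 ∧ 39 / 50 * a₀ ≤ h₀ ∧ h₀ ≤ 17 / 20 * a₀) ∧ ∀ (a h : ℝ) (ha : a ≠ 0) (hh : h ≠ 0), 47 / 50 ≤ a ∧ a ≤ 1 ∧ 39 / 50 * a ≤ h ∧ h ≤ 17 / 20 * a → (Literature.MathematicalPhysics.StatisticalMechanics.hcpPeriodicConfiguration ha₀ hh₀).energyPerParticle Literature.MathematicalPhysics.StatisticalMechanics.lennardJones + c * ((a - a₀) ^ 2 + (h - h₀) ^ 2) ≤ (Literature.MathematicalPhysics.StatisticalMechanics.hcpPeriodicConfiguration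 ha hh).energyPerParticle Literature.MathematicalPhysics.StatisticalMechanics.lennardJones :=
  PricedHcpWindowsBoxModulus.stub_boxModulusOfShape PricedHcpWindowsShapeModulus.stub_shapeModulus
    PricedHcpWindowsRatioLipschitz.stub_ratioLipschitz

end Summit.AtomisticToContinuum.Crystallization.Theorems.PricedHcpWindowsHcpBoxModulus
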